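/-
Copyright (c) 2026 the pub-hodgecm-mathlib formalisation cell (harness21).  Prover seat hodgecm-mathlib-K2Liu-p12 (g5), Track B «K2-LIT»,
#184♮ = hLiu418 = `stmt-HodgeConjecture-24832`; #41 middle term (K0-mid), TIE-SIDE LETTER for I4 ED. 5 «PREIMAGE LEVEL» (★ p862751, K2E4-p11 (g8)):
the level `KG := Λ⁻¹(𝒦.K)` with `hKGo`, `hKGfi`, `hΛK` (LEAD F0P6-plan (g14) BATCH #111 (2); road (R-a) of RULING M-158j).  THEOREMS ONLY (no `def`, no
`instance`, no `notation`, no named-fact hypothesis, no `sorry`).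
-/
import Summits.HodgeConjecture.HodgeConjecture.Theorems.K2LiuSiegelMiddleTermLevelLetters   -- ★ p862505 (this seat); brings ★ `IwasawaDatum.IsStd` API, `GLn.*`, `UnitaryGroup.archPart∕finPart`
import Literature.NumberTheory.Automorphic.GLnMaximalCompactCompact                          -- ★ `compactSpace_standardMaximalCompactGL`
import Mathlib.Topology.Algebra.OpenSubgroup                                                  -- `Subgroup.quotient_finite_of_isOpen`
import HarnessLib

/-!
# Crux `HLiu418`, socket #41 (K0-mid), TIE-SIDE LETTER `K2LiuSiegelMiddleTermPreimageLevel`: THE PREIMAGE LEVEL `KG := Λ⁻¹(𝒦.K)` IS OPEN AND OF FINITE INDEX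
# IN `K = K_∞·GL_n(𝒪̂_L)` AS SOON AS `Λ(K)` HAS ARCHIMEDEAN COMPONENTS IN `𝒦.K`

Cell `hodgecm-mathlib`, crux item hLiu418 = `stmt-HodgeConjecture-24832`; squad K2 ∕ K2Liu, road `K2_Liu`, socket #41; LEAD F0P6-plan (g14) BATCH #111 (2); I4 desk K2E4-p11 (g8).
Lane `--supports stmt-HodgeConjecture-24832 --as helper` (count-neutral helper; closes no socket by itself).

WHY.  ★ I4 ED. 5 `K2LiuSiegelEisensteinMiddleTermOfStandardLevel.exists_middleTerm_package_of_standard_level` (over ★ I3 ED. 2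
`K2LiuSiegelMiddleTermKTypesLevel.exists_KTypes_package_level`, this seat) carries the preimage level BY VALUE:
`(KG : Subgroup (GL (Fin 2) (AdeleRing (𝓞 L) L))) (hKGo : IsOpen (KG.subgroupOf K)) (hKGfi : (KG.subgroupOf K).FiniteIndex) (hΛK : ∀ k ∈ KG, Λ k ∈ 𝒦.K)`.  THIS FILE pays the
three letters at the tie from the STANDARD SHAPE of the datum (★ `IwasawaDatum.IsStd`: `𝒦.K = C_∞·C_f` with `C_f` OPEN, read through ★ `archPart`∕`finPart`), the continuity of
the Levi homomorphism `Λ`, and ONE archimedean letter BY VALUE — the Levi-adaptedness of the datum at infinity,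
  `harchK : ∀ k : ↥K, archToAdelic (archPart (Λ k)) ∈ 𝒦.K` («`(Λ k)_∞ ∈ C_∞`»),
which is generic-false for the socket's arbitrary `𝒦` (RULING M-158j) and is supplied by road (R-c) — the transported datum of ★ (T3-arch)
`K2LiuArchMajorantTransitivity.exists_isSiegelDelta_conjDatum_arch_iff` has the archimedean compact of the Levi-compatible reference (`(a, 1) ∈ 𝒦.K ↔ (a, 1) ∈ 𝒦₁.K`),
so `harchK` is decided at the reference datum once.  With `KG := (𝒦.K).comap Λ`: `hΛK` by construction; for `k ∈ K`,
`Λ k = (Λ k)_∞ · (Λ k)_f` (★ `archToAdelic_mul_finAdelicToAdelic`) with `(Λ k)_∞ ∈ 𝒦.K` (`harchK`), so `Λ k ∈ 𝒦.K ↔ (Λ k)_f ∈ C_f` (★ `IsStd.exists_fin`): the trace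
`KG ⊓ K` is the preimage of the OPEN `C_f` under the continuous `k ↦ (Λ k)_f` — OPEN —, and an open subgroup of the COMPACT `K` (★ `compactSpace_standardMaximalCompactGL`) has
finite index (Mathlib `Subgroup.quotient_finite_of_isOpen`, `Subgroup.finiteIndex_of_finite_quotient`).
* §1 `mem_levi_iff_finPart_mem` — `Λ k ∈ 𝒦.K ↔ finPart (Λ k) ∈ C_f` under `harchK`;
* §2 **`exists_preimageLevel`** — `∃ KG, hKGo ∧ hKGfi ∧ hΛK` in I4 ED. 5's binder BYTES (general `n`; at the datum `n := 2`).
[cite: BorelJacquet1979, §4.1] [cite: Tan1999, §1 p. 166] [cite: PlatonovRapinchuk1994, §5.1]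
HONEST LABEL.  Count-neutral helper; it retires nothing by itself: `HC_CM` is proved only modulo the 7 printed citations (2 remaining named inputs:
hLiu418 = `stmt-HodgeConjecture-24832`, h413 = `stmt-HodgeConjecture-24833`) until rung 0 closes.

## References
* [BorelJacquet1979] A. Borel, H. Jacquet, *Automorphic forms and automorphic representations*, PSPM 33.1 (1979), §4.1 (`G(𝔸) = G_∞ × G(𝔸_f)`, open compact levels).
* [Tan1999] V. Tan, Canad. J. Math. 51 (1999), §1 p. 166 (`K = K_∞ ∏ K_v`, standard sections).
* [PlatonovRapinchuk1994] V. Platonov, A. Rapinchuk, *Algebraic Groups and Number Theory* (1994), §5.1 (open subgroups of compact adelic groups have finite index).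
-/

set_option autoImplicit false
set_option linter.dupNamespace false -- the mandated namespace repeats `HodgeConjecture.HodgeConjecture`

noncomputable section

open scoped Matrix Topology
open NumberField IsDedekindDomain
open Literature.NumberTheory.Automorphic Literature.NumberTheory.GaloisRepresentations
open Literature.NumberTheory.GelbartRogawski1991 Literature.NumberTheory.GelbartRogawski1991.GRConstruction
open Literature.NumberTheory.K2Lit.SiegelDoubled

namespace Summit.HodgeConjecture.HodgeConjecture.Cruxes.HLiu418.K2LiuSiegelMiddleTermPreimageLevel

variable (L : Type) [Field L] [NumberField L] [IsCMField L]
variable {N M n : ℕ} (e : Fin N × Fin M ≃ Fin n)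
  (dV : Fin N → L) (hdV : ∀ i, IsCMField.complexConj L (dV i) = dV i)
  (dW : Fin M → L) (hdW : ∀ i, IsCMField.complexConj L (dW i) = dW i)

/-! ## §1 Membership in `Λ⁻¹(𝒦.K)` is a finite-place condition under `harchK` -/

/-- **`Λ k ∈ 𝒦.K ↔ (Λ k)_f ∈ C_f`** for the finite half `C_f` of a standard datum (★ `IsStd.exists_fin`: `u ∈ C_f → (1, u) ∈ 𝒦.K`, `k ∈ 𝒦.K → k_f ∈ C_f`) when the archimedean
component `((Λ k)_∞, 1)` lies in `𝒦.K` (`harchK`): `Λ k = ((Λ k)_∞, 1)·(1, (Λ k)_f)` (★ `archToAdelic_mul_finAdelicToAdelic`). [cite: BorelJacquet1979, §4.1] -/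
theorem mem_levi_iff_finPart_mem (𝒦 : IwasawaDatum L e dV hdV dW hdW)
    {Cfin : Subgroup (UnitaryGroup.finAdelic (Fp L) L (IsCMField.complexConj L) (n + n) (hermD L e dV hdV dW hdW))}
    (hCK : ∀ u ∈ Cfin, (UnitaryGroup.finAdelicToAdelic (Fp L) L (IsCMField.complexConj L) (n + n) (hermD L e dV hdV dW hdW) u : HA L e dV hdV dW hdW) ∈ 𝒦.K)
    (hKC : ∀ k : HA L e dV hdV dW hdW, k ∈ 𝒦.K → UnitaryGroup.finPart (Fp L) L (IsCMField.complexConj L) (n + n) (hermD L e dV hdV dW hdW) k ∈ Cfin)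
    {x : HA L e dV hdV dW hdW}
    (harch : (UnitaryGroup.archToAdelic (Fp L) L (IsCMField.complexConj L) (n + n) (hermD L e dV hdV dW hdW)
      (UnitaryGroup.archPart (Fp L) L (IsCMField.complexConj L) (n + n) (hermD L e dV hdV dW hdW) x) : HA L e dV hdV dW hdW) ∈ 𝒦.K) :
    x ∈ 𝒦.K ↔ UnitaryGroup.finPart (Fp L) L (IsCMField.complexConj L) (n + n) (hermD L e dV hdV dW hdW) x ∈ Cfin := by
  refine ⟨hKC x, fun hx => ?_⟩
  rw [← UnitaryGroup.archToAdelic_mul_finAdelicToAdelic (Fp L) L (IsCMField.complexConj L) (n + n) (hermD L e dV hdV dW hdW) x]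
  exact 𝒦.K.mul_mem harch (hCK _ hx)

/-! ## §2 The preimage level -/

/-- **THE PREIMAGE LEVEL OF A STANDARD DATUM IS OPEN AND OF FINITE INDEX IN `K`.**  For a STANDARD Iwasawa datum `𝒦` (★ `IwasawaDatum.IsStd`), a continuous homomorphism
`Λ : GL_n(𝔸_L) →* H(𝔸)` and the archimedean letter `harchK : ((Λ k)_∞, 1) ∈ 𝒦.K` for `k ∈ K = K_∞·GL_n(𝒪̂_L)` (Levi-adaptedness at infinity, supplied by road (R-c)): with
`KG := Λ⁻¹(𝒦.K)` — (`hKGo`) `KG ∩ K` is OPEN in `K` (it is `{k | (Λ k)_f ∈ C_f}`, §1, `C_f` open, `Λ` and ★ `finPart` continuous); (`hKGfi`) it has FINITE INDEX in `K`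
(`K` compact ★ `compactSpace_standardMaximalCompactGL`; Mathlib `Subgroup.quotient_finite_of_isOpen`); (`hΛK`) `Λ(KG) ⊆ 𝒦.K` by construction — the three binders of ★ I4 ED. 5
`exists_middleTerm_package_of_standard_level` (at `n := 2`) VERBATIM. [cite: BorelJacquet1979, §4.1] [cite: Tan1999, §1 p. 166] [cite: PlatonovRapinchuk1994, §5.1] -/
theorem exists_preimageLevel {𝒦 : IwasawaDatum L e dV hdV dW hdW} (h𝒦 : 𝒦.IsStd)
    (Λ : GL (Fin n) (AdeleRing (𝓞 L) L) →* HA L e dV hdV dW hdW) (hΛc : Continuous Λ)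
    (harchK : ∀ k : ↥(standardMaximalCompactGL n L),
      (UnitaryGroup.archToAdelic (Fp L) L (IsCMField.complexConj L) (n + n) (hermD L e dV hdV dW hdW)
        (UnitaryGroup.archPart (Fp L) L (IsCMField.complexConj L) (n + n) (hermD L e dV hdV dW hdW) (Λ (k : GL (Fin n) (AdeleRing (𝓞 L) L)))) :
          HA L e dV hdV dW hdW) ∈ 𝒦.K) :
    ∃ KG : Subgroup (GL (Fin n) (AdeleRing (𝓞 L) L)),
      IsOpen ((KG.subgroupOf (standardMaximalCompactGL n L) : Subgroup ↥(standardMaximalCompactGL n L)) : Set ↥(standardMaximalCompactGL n L)) ∧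
      (KG.subgroupOf (standardMaximalCompactGL n L)).FiniteIndex ∧
      (∀ k ∈ KG, Λ k ∈ 𝒦.K) := by
  obtain ⟨Cfin, hCo, hCK, hKC⟩ := h𝒦.exists_fin
  haveI : CompactSpace ↥(standardMaximalCompactGL n L) := compactSpace_standardMaximalCompactGL n L
  -- the trace on `K` is the preimage of the open `C_f` under `k ↦ (Λ k)_f`, hence open
  have hset : (((𝒦.K.comap Λ).subgroupOf (standardMaximalCompactGL n L) : Subgroup ↥(standardMaximalCompactGL n L)) : Set ↥(standardMaximalCompactGL n L)) =
      (fun k : ↥(standardMaximalCompactGL n L) =>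
        UnitaryGroup.finPart (Fp L) L (IsCMField.complexConj L) (n + n) (hermD L e dV hdV dW hdW) (Λ (k : GL (Fin n) (AdeleRing (𝓞 L) L)))) ⁻¹'
        (Cfin : Set (UnitaryGroup.finAdelic (Fp L) L (IsCMField.complexConj L) (n + n) (hermD L e dV hdV dW hdW))) := by
    ext k
    rw [SetLike.mem_coe, Subgroup.mem_subgroupOf, Subgroup.mem_comap, Set.mem_preimage, SetLike.mem_coe]
    exact mem_levi_iff_finPart_mem L e dV hdV dW hdW 𝒦 hCK hKC (harchK k)
  have hopen : IsOpen (((𝒦.K.comap Λ).subgroupOf (standardMaximalCompactGL n L) : Subgroup ↥(standardMaximalCompactGL n L)) :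
      Set ↥(standardMaximalCompactGL n L)) := by
    rw [hset]
    exact hCo.preimage ((UnitaryGroup.continuous_finPart (Fp L) L (IsCMField.complexConj L) (n + n) (hermD L e dV hdV dW hdW)).comp
      (hΛc.comp continuous_subtype_val))
  -- an open subgroup of the compact `K` has finite index
  haveI := Subgroup.quotient_finite_of_isOpen _ hopen
  exact ⟨𝒦.K.comap Λ, hopen, Subgroup.finiteIndex_of_finite_quotient, fun k hk => Subgroup.mem_comap.1 hk⟩

end Summit.HodgeConjecture.HodgeConjecture.Cruxes.HLiu418.K2LiuSiegelMiddleTermPreimageLevel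

end
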